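import Summits.BirchSwinnertonDyer.BirchSwinnertonDyer.Theorems.KolyvaginRoadThreeMethod2Defs
import Literature.NumberTheory.EllipticCurves.KummerSelmerStructure
import Literature.NumberTheory.EllipticCurves.SelmerFiniteProofs
import Literature.NumberTheory.EllipticCurves.SelmerUnramified
import Literature.NumberTheory.EllipticCurves.GaloisActionProofs
import Literature.NumberTheory.GaloisRepresentations.LocalGlobalCohomologyFiniteProofs
import Mathlib.GroupTheory.Index
import HarnessLib

/-!
# Route `KolyvaginRoadThree`, deciding crux `ZhangSharpFrameAtThreeHL` (item stmt-BirchSwinnertonDyer-19574):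
# basic facts on the canonical level-raised Selmer spaces of the METHOD skeleton `Method2`
# (cell `bsd-stepL`, seat `bsd-stepL-zhang3-p1` g5; `--supports stmt-BirchSwinnertonDyer-19574`, helper)

Two pieces of bookkeeping every prover of the registered stubs `stub_levelRaisingAtThree` ∕
`stub_kolyvaginClassesAtThree` (data in `Theorems/KolyvaginRoadThreeMethod2Defs.lean`, p456348) needs and should not
redo:

* `levelSelmerSubgroup_empty` — at the BOTTOM level (`n = ∅`, nothing relaxed) the canonical space IS the
  `μ`-eigenspace of complex conjugation on the tree's `3`-Selmer group `selmerGroup (W.baseChange K) 3`: so every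
  tree fact about `Sel₃(E/K)` (Gross 1991 §10 machinery, the `Koly.*` files) applies to `SelQ W K c ∅ μ` verbatim.
* `finite_levelSelmerSubgroup` ∕ `finiteDimensional_selRelQ` ∕ `finiteDimensional_selQ` — the canonical space
  relaxed at a FINITE set of admissible primes is finite(-dimensional over `ZMod 3`). Proof (Milne ADT I §6 ∕
  Silverman X.4.2 style): intersecting with the kernels of the localisation maps at the finitely many places above
  `n ∪ S` — each of finite index, `H¹(K_v, E[3])` being finite (tree `finite_galoisCohomology_one_toLocal`) — lands
  inside `Sel₃(E/K)`, which is finite (tree `finite_selmerGroup_holds`); a group with a finite subgroup of finite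
  index is finite. (For an INFINITE relaxation set the space is infinite-dimensional — the point of repair (R1) in
  `zhang3/STUB-MISSTATED-19574-method2.md`; nothing is claimed here about that case.)

HONEST FRAMING. Elementary consequences of the definitions and of landed tree theorems; no named fact, no `sorry`,
0 defs. PARTITION: O2@3 (B10) × A1 × crux 19574 — none (bookkeeping for the method skeleton; types nothing, closes
nothing; T7). [cite: WZhang2014, §5 (Sel_{𝔭_n}), Lemma 8.4 (3)] [cite: SilvermanAEC2009, Thm X.4.2(b)]
-/

noncomputable section

open scoped Classical

namespace Summit.BirchSwinnertonDyer.Rank1Residual.X11b.Three.Koly.Method2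

open WeierstrassCurve NumberField IsDedekindDomain
  Literature.NumberTheory.EllipticCurves Literature.NumberTheory.GaloisRepresentations Module

variable (W : WeierstrassCurve ℚ) (K : Type) [Field K] [NumberField K] (c : K ≃ₐ[ℚ] K)

/-! ## The bottom level: `Sel_∅^μ` is the `μ`-eigenspace of `Sel₃(E/K)` -/

/-- **At level `∅`, relaxed nowhere, the canonical space is the `μ`-eigenspace of the tree's `3`-Selmer group**:
`levelSelmerSubgroup W K c ∅ ∅ μ = ker (τ − sgn μ) ⊓ Sel₃(E/K)` (the ordinary conditions are indexed by the empty
set, the Kummer conditions by all places). [cite: WZhang2014, §5 (Sel_{𝔭_n} at n = 1)] -/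
theorem levelSelmerSubgroup_empty (μ : Bool) :
    levelSelmerSubgroup W K c ∅ ∅ μ =
      (conjAct W c ((3 ^ 1 : ℕ) : ℤ) - sgn μ • AddMonoidHom.id (V3 W K)).ker ⊓
        selmerGroup (W.baseChange K) ((3 ^ 1 : ℕ) : ℤ) := by
  ext x
  simp only [levelSelmerSubgroup, WeierstrassCurve.mem_selmerGroup_iff, AddSubgroup.mem_inf,
    AddSubgroup.mem_iInf, Finset.coe_empty, Set.empty_union, Set.mem_empty_iff_false, imp_true_iff,
    Finset.notMem_empty, false_and, IsEmpty.forall_iff, and_true, true_imp_iff]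
  tauto

/-- Membership form of `levelSelmerSubgroup_empty`: `x ∈ SelQ W K c ∅ μ` iff `x` is a `3`-Selmer class of `E/K` in
the `sgn μ`-eigenspace of complex conjugation. [cite: WZhang2014, §5 (Sel_{𝔭_n} at n = 1)] -/
theorem mem_selQ_empty_iff [W.IsGloballyMinimal] [Module (ZMod 3) (V3 W K)] (μ : Bool) (x : V3 W K) :
    x ∈ SelQ W K c ∅ μ ↔
      conjAct W c ((3 ^ 1 : ℕ) : ℤ) x = sgn μ • x ∧ x ∈ selmerGroup (W.baseChange K) ((3 ^ 1 : ℕ) : ℤ) := by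
  change x ∈ (AddSubgroup.toZModSubmodule 3 (levelSelmerSubgroup W K c (Finset.image Subtype.val ∅) ∅ μ) :
    Set (V3 W K)) ↔ _
  rw [AddSubgroup.coe_toZModSubmodule, Finset.image_empty, levelSelmerSubgroup_empty]
  simp only [AddSubgroup.coe_inf, Set.mem_inter_iff, SetLike.mem_coe, AddMonoidHom.mem_ker, AddMonoidHom.sub_apply,
    sub_eq_zero]
  exact Iff.rfl

/-! ## Finiteness of the canonical spaces relaxed at finitely many primes -/

/-- The finite places of `K` above the primes of a finite set `T ∌ 0` of natural numbers form a finite set.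
[folklore] -/
theorem finite_placesAbove (T : Set ℕ) (hT : T.Finite) (h0 : (0 : ℕ) ∉ T) :
    {v : HeightOneSpectrum (𝓞 K) | ∃ q ∈ T, (q : 𝓞 K) ∈ v.asIdeal}.Finite := by
  have : {v : HeightOneSpectrum (𝓞 K) | ∃ q ∈ T, (q : 𝓞 K) ∈ v.asIdeal} =
      ⋃ q ∈ T, {v : HeightOneSpectrum (𝓞 K) | (q : 𝓞 K) ∈ v.asIdeal} := by
    ext v
    simp only [Set.mem_setOf_eq, Set.mem_iUnion, exists_prop]
  rw [this]
  refine hT.biUnion fun q hq ↦ ?_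
  have hq0 : (q : ℤ) ≠ 0 := by
    rintro h
    exact h0 (by rwa [Int.natCast_eq_zero.mp h] at hq)
  have h := WeierstrassCurve.finite_setOf_intCast_mem_asIdeal (K := K) hq0
  simpa only [Int.cast_natCast] using h

/-- The kernel of the localisation `H¹(K, E[n]) → H¹(K_v, E[n])` (Selmer-structure vocabulary) lies in the Selmer
local kernel at `v` (a class vanishing in `H¹(K_v, E[n])` vanishes in `H¹(K_v, E)`): `ker = comap ⊥ ≤ comap 𝓚_v`,
and `comap 𝓚_v` is the tree's `selmerLocalKer` (`comap_localization_kummerSelmerStructure`). [folklore] -/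
theorem ker_localization_le_selmerLocalKer {F : Type} [Field F] [NumberField F] (W' : WeierstrassCurve F) (N : ℤ)
    (v : HeightOneSpectrum (𝓞 F)) :
    (galoisCohomology.localization (W'.torsionGaloisModule N) (Sum.inr v) 1).ker ≤
      selmerLocalKer W' (v.adicCompletion F) N := by
  rw [← selmerLocalKer_completion_inr, ← W'.comap_localization_kummerSelmerStructure N (Sum.inr v)]
  exact AddSubgroup.comap_mono bot_le

/-- **The canonical level-raised Selmer space relaxed at a FINITE set is finite.** For a finite set `n` and a finite
set `S` of NON-ZERO natural numbers, `levelSelmerSubgroup W K c n S μ` is a finite group: cut by the (finite-index)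
kernels of the localisations at the finitely many places above `n ∪ S` it lies in `Sel₃(E/K)` (finite, tree
`finite_selmerGroup_holds`). Silverman X.4.2(b) ∕ Milne ADT I.6 for a modified Selmer structure.
[cite: SilvermanAEC2009, Thm X.4.2(b)] -/
theorem finite_levelSelmerSubgroup [W.IsElliptic] (n : Finset ℕ) (S : Set ℕ) (hS : S.Finite)
    (h0 : (0 : ℕ) ∉ (n : Set ℕ) ∪ S) (μ : Bool) : Finite (levelSelmerSubgroup W K c n S μ) := by
  set N3 : ℤ := ((3 ^ 1 : ℕ) : ℤ) with hN3
  have hN3ne : N3 ≠ 0 := by norm_num [hN3]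
  set ρ := (W.baseChange K).torsionGaloisModule N3 with hρ
  -- the finitely many places above `n ∪ S`
  set P : Set (HeightOneSpectrum (𝓞 K)) := {v | ∃ q ∈ (n : Set ℕ) ∪ S, (q : 𝓞 K) ∈ v.asIdeal} with hP
  have hPfin : P.Finite := finite_placesAbove K ((n : Set ℕ) ∪ S) (n.finite_toSet.union hS) h0
  haveI : Finite P := hPfin.to_subtype
  -- `E[3]` is finite, hence so is every `H¹(K_v, E[3])`
  haveI : Finite (geomTorsion (W.baseChange K) N3) :=
    finite_torsionPoints_holds (W.baseChange K) (AlgebraicClosure K) hN3ne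
  -- the localisation kernels at the places of `P`, each of finite index
  let L : P → AddSubgroup (V3 W K) := fun v ↦ (galoisCohomology.localization ρ (Sum.inr v.1) 1).ker
  have hLfi : ∀ v, (L v).FiniteIndex := fun v ↦ by
    haveI : Finite (galoisCohomology (ρ.toLocal (Sum.inr v.1)) 1) := finite_galoisCohomology_one_toLocal ρ v.1
    haveI : Finite (galoisCohomology.localization ρ (Sum.inr v.1) 1).range := inferInstance
    exact AddSubgroup.finiteIndex_ker _
  set Nk : AddSubgroup (V3 W K) := ⨅ v, L v with hNk
  haveI hNkfi : Nk.FiniteIndex := AddSubgroup.finiteIndex_iInf hLfi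
  -- inside the kernels, the relaxed space lies in the Selmer group
  set Lsel := levelSelmerSubgroup W K c n S μ with hLsel
  have hle : Lsel ⊓ Nk ≤ selmerGroup (W.baseChange K) N3 := by
    intro x hx
    obtain ⟨hxL, hxN⟩ := AddSubgroup.mem_inf.mp hx
    rw [mem_selmerGroup_iff]
    have hxL' := hxL
    simp only [hLsel, levelSelmerSubgroup, AddSubgroup.mem_inf, AddSubgroup.mem_iInf] at hxL'
    obtain ⟨-, hinf, hfin, -⟩ := hxL'
    refine ⟨fun v ↦ ?_, fun w ↦ hinf w⟩
    by_cases hv : v ∈ P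
    · -- at a place above `n ∪ S`: localisation zero ⇒ Kummer condition
      have hxv : x ∈ L ⟨v, hv⟩ := (AddSubgroup.mem_iInf.mp hxN) ⟨v, hv⟩
      exact ker_localization_le_selmerLocalKer (W.baseChange K) N3 v hxv
    · -- away from `n ∪ S`: the Kummer condition is imposed
      refine hfin v fun q hq hqv ↦ hv ⟨q, hq, hqv⟩
  -- the Selmer group is finite, hence so is `Lsel ⊓ Nk`
  haveI hSelfin : Finite (selmerGroup (W.baseChange K) N3) :=
    (W.baseChange K).finite_selmerGroup_holds hN3ne
  have hinf_fin : Finite (Lsel ⊓ Nk : AddSubgroup (V3 W K)) :=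
    Finite.of_injective (fun x ↦ (⟨x.1, hle x.2⟩ : selmerGroup (W.baseChange K) N3))
      (fun x y h ↦ Subtype.ext (by simpa using congrArg Subtype.val h))
  -- a group with a finite subgroup of finite index is finite
  rw [AddSubgroup.finite_iff_finite_and_finiteIndex (Nk.addSubgroupOf Lsel)]
  refine ⟨?_, inferInstance⟩
  exact Finite.of_injective
    (fun x : Nk.addSubgroupOf Lsel ↦ (⟨x.1.1, AddSubgroup.mem_inf.mpr ⟨x.1.2, x.2⟩⟩ : (Lsel ⊓ Nk : AddSubgroup _)))
    (fun x y h ↦ Subtype.ext (Subtype.ext (by simpa using congrArg (fun z ↦ z.1) h)))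

variable [W.IsGloballyMinimal]

/-- Unipotent-admissible primes are primes, in particular non-zero. [folklore] -/
theorem IsUAdmissiblePrime.ne_zero {q : ℕ} (hq : IsUAdmissiblePrime W K q) : q ≠ 0 := hq.1.ne_zero

/-- **`SelRel_n,S^μ` is finite-dimensional for a FINITE set `S` of admissible primes** (in particular the
un-relaxed `Sel_n^μ`, `finiteDimensional_selQ`). Not true for infinite `S`. [cite: WZhang2014, Lemma 8.4 (3)
(relaxed Selmer group)] -/
theorem finiteDimensional_selRelQ [W.IsElliptic] [Module (ZMod 3) (V3 W K)]
    (n : Finset {q // IsUAdmissiblePrime W K q}) {S : Set {q // IsUAdmissiblePrime W K q}} (hS : S.Finite)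
    (μ : Bool) : FiniteDimensional (ZMod 3) (SelRelQ W K c n S μ) := by
  have hfin : Finite (levelSelmerSubgroup W K c (n.image Subtype.val) (Subtype.val '' S) μ) := by
    refine finite_levelSelmerSubgroup W K c _ _ (hS.image _) ?_ μ
    rintro (h | h)
    · rw [Finset.mem_coe, Finset.mem_image] at h
      obtain ⟨q, -, hq⟩ := h
      exact IsUAdmissiblePrime.ne_zero W K q.2 hq
    · obtain ⟨q, -, hq⟩ := h
      exact IsUAdmissiblePrime.ne_zero W K q.2 hq
  have hfin' : Finite (SelRelQ W K c n S μ) := by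
    change Finite (AddSubgroup.toZModSubmodule 3 (levelSelmerSubgroup W K c (n.image Subtype.val) (Subtype.val '' S) μ))
    exact Finite.of_equiv _ (Equiv.setCongr (AddSubgroup.coe_toZModSubmodule 3 _).symm)
  exact Module.Finite.of_finite

/-- **`Sel_n^μ` is finite-dimensional.** [cite: WZhang2014, §5 (Sel_{𝔭_n})] -/
theorem finiteDimensional_selQ [W.IsElliptic] [Module (ZMod 3) (V3 W K)]
    (n : Finset {q // IsUAdmissiblePrime W K q}) (μ : Bool) : FiniteDimensional (ZMod 3) (SelQ W K c n μ) := by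
  rw [selQ_eq_selRelQ_empty]
  exact finiteDimensional_selRelQ W K c n Set.finite_empty μ

end Summit.BirchSwinnertonDyer.Rank1Residual.X11b.Three.Koly.Method2

end
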